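import Mathlib
import HarnessLib
import HarnessLib.Audit
import Summits.QuantumFields.Statement

/-!
Route: OneCertifiedCube

DORMANT since 2026-09-03T10:20:24Z (reconciler: no traction for 5 d (last activity statement-checked at 2026-08-29T09:29:08Z); parked, not closed — `ledger route dormant route-QuantumFields-OneCertifiedCube --off` to reactivate) — unstaffed, not closed; items shared with open routes are served there. `ledger route dormant <id> --off` reactivates.

# Route OneCertifiedCube — TV finite-size mixing criterion at the crossover scale, certified once,
propagated along a_k by a universal-threshold theorem

It suffices to show X = F ∧ E ∧ C ∧ P, realising card finite-size-criterion-crossover ("one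
certified cube") in TOTAL-VARIATION form on the honest
Wilson specification: (F, engine) a finite-size criterion with a UNIVERSAL threshold — if, for cells
of a [b,2b]-frame of ℤ⁴, the influence in
total variation of ANY change of boundary condition outside the cube of (4n+1)⁴ cells on the central
cell is ≤ ε with ε·M(n) < 1,
M(n) = (4n+3)⁴ − (4n+1)⁴, then all connected correlations of gauge-invariant local observables on
all tori of side ≥ (8n+7)b decay like
e^{−κ t/b}, κ = κ(n, ε) only; (E, existence leg) for every compact simple G a non-trivial
non-Gaussian continuum limit T of Wilson's theory
exists along a WEAK-COUPLING scheme (a_k → 0, β_k → ∞ i.e. `HasWeakCouplingLimit`, a_k L_k → ∞;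
statement re-type 2026-08-16); (C, the certificate = the card's crux) along any such scheme the
finite-size condition holds at ONE fixed
physical scale ℓ (block b_k = ⌈ℓ/a_k⌉) for all large k; (P) a volume-uniform lattice gap with ONE
pair-independent threshold k₀ passes to `T.HasMassGap`. Then Δ = κ/(2ℓ).
Lean: `FiniteSizeCriterion ∧ ContinuumLimitExists ∧ CrossoverCertificate ∧ GapToContinuum` (the four
decls below; the deciding theorem `closes : F → E → C → P → YangMills` — also the Assembly item — is
plumbing + ceil/`∀ᶠ` bookkeeping, sorry-free and gate-checked, rev 4)

## Assembly
Fix G; E gives r, sch, T with β_k → ∞ (`sch.HasWeakCouplingLimit`: returned as the statement's first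
conjunct and handed to C and P), IsYangMillsFor, IsNontrivial, IsNonGaussian; C gives ℓ, n, ε and,
eventually in k, the finite-size condition at
b_k = ⌈ℓ/a_k⌉; F gives κ(n, ε) and for each pair (A, B) a constant C valid for all β, b, S, t. Put Δ
:= κ/(2ℓ). From ONE pair-independent threshold k₀ on (finite-size condition at b_k ∧ a_k ≤ ℓ ∧
(8n+7)ℓ ≤ a_k L_k, so
b_k a_k ≤ 2ℓ, e^{−κt/b_k} ≤ e^{−Δ a_k t} and (8n+7) b_k ≤ 2L_k+1) every pair (A, B) clusters at rate
Δ a_k on every torus 2S+1 ≥ 2L_k+1 for all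
t ≤ S: the PAIR-UNIFORM lattice gap, whence `HasLatticeMassGap r sch Δ`; P turns the pair-uniform
gap into `T.HasMassGap Δ`. Instance plumbing
(borel σ-algebra `letI`), ceil arithmetic and `Filter.Eventually` bookkeeping only — no mathematics
beyond the four hypotheses (closes, rev 4).

Rationale: WHY THIS LINE. The card isolates the one non-perturbative step of the Clay problem into a decidable
inequality on one cube and proves the infinite volume by a soft
theorem (Dobrushin–Shlosman constructive criterion DobrushinShlosman1985/1987, computer-verified on
one volume in DobrushinKolafaShlosman1985 and,
for RG block measures, Kennedy1993/HallerKennedy1996). The refuter's objection was that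
DS/Martinelli–Olivieri criteria need a bounded finite-range
POTENTIAL (constants e^{c‖J‖}, Martinelli1999 Prop. 2.9/Lemma 2.10, Martinelli2000), which Bałaban's
effective action (tails, large fields;
Balaban1988Convergent) is not. This route removes the potential from the statement: the criterion
(F) is phrased on the specification KERNELS
`ymSpecification` of the fine Wilson theory, in total variation, where a coupling/chain-rule
recursion (disagreement-percolation style,
BergMaes1994, DyerEtAl2004, Weitz2005) closes with the purely combinatorial threshold ε·M(n) < 1 and
no interaction norm; gauge covariance is
automatic (TV on the full cell σ-algebra equals TV on gauge-invariant events, by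
`ymSpecification_map_gaugeTransformZd`); tori of every side are
handled by [b,2b]-cell frames. All of the difficulty is pushed into ONE statement (C): k-uniform
smallness of a bounded, UV-meaningful quantity
(boundary influence at physical distance 2ℓ), which is exactly what an enclosure of the crossover
effective action + openness (the card) — or
any other UV technology — would deliver; imported areas: Gibbs-measure mixing theory (probability),
constructive RG (Bałaban), lattice
phenomenology only for the numbers (Luscher1986, KollerVanbaal1986). Nothing in the negatives index
(empty) is touched; no prior route exists.

RANKED CRUXES. #2 CrossoverCertificate (crux) — (card K1+K3, the certificate with openness built in;
re-typed 2026-08-16 to weak-coupling schemes) for every compact simple G, every faithful lattice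
representation r, every scheme sch with β_k → ∞ (`sch.HasWeakCouplingLimit`) and OS data T with
`IsYangMillsFor r sch T`, non-trivial and non-Gaussian curvature field, there are a physical length
ℓ > 0, n ≥ 1 and ε ≥ 0 with ε·M(n) < 1 such that for all large k the TV finite-size condition holds
for the Wilson specification at β_k with cell size b_k = ⌈ℓ/a_k⌉: for every [b_k,2b_k]-frame w,
every cell-union A inside the cube of (4n+1)⁴ cells containing the central cell, every pair of
boundary conditions agreeing on the cube, and every [0,1]-valued measurable cylinder function f of
the central cell, |∫f dγ_A(·|η) − ∫f dγ_A(·|η′)| ≤ ε. [difficulty: open-problem] (why it might fail: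
TV sup over ALL exterior data including COHERENT cutoff-scale boundary layers (constant abelian flux
sheets): in the massive-Gaussian/abelian caricature the TV influence → 1 linearly in b = ℓ/a_k
(refuter rreview g3, gff_tv.py, job j001681), so C is a bet on YM-specific non-perturbative
self-screening as β_k → ∞; ε<1/1776 forces ℓ≈5/m, i.e. a (35/m)⁴ certified volume.)
[DobrushinShlosman1985, DobrushinKolafaShlosman1985, HallerKennedy1996, Kennedy1993,
Balaban1989LargeFieldII, Guth1980, tHooft1979Flux, Luscher1986, KollerVanbaal1986]
#3 ContinuumLimitExists (crux) — (existence leg AT WEAK COUPLING = the re-typed statement's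
existence clauses without the gap; cards parabolic-renormalised-trajectory /
flow-line-state-space-4d are its natural suppliers) for every compact simple G there are a faithful
lattice representation r, a sequential scheme sch (a_k → 0, a_k L_k → ∞, β_k → ∞ i.e.
`sch.HasWeakCouplingLimit` — the limit is taken at the asymptotically free UV fixed point, a
hypothetical finite-β critical point no longer qualifies — and renormalisations) and OS data T (E0,
E0′, E1–E4 as fields) for all gauge-invariant local observables with `IsYangMillsFor r sch T`,
`T.IsNontrivial r.curvature` and `T.IsNonGaussian r.curvature`. [difficulty: open-problem] (why it
might fail: This is existence of continuum YM₄ with E0–E4 (E1 full rotations, E0′ growth) and a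
non-Gaussian tr F² along β_k → ∞: Bałaban's programme stops at UV stability (barrier
UVStabilityNonUniqueness); rotation invariance and a 3-point lower bound for the composite field are
open.) [Balaban1987RG1, Balaban1989LargeFieldII, Balaban1988Convergent, MagnenRivasseauSeneor1993,
JaffeWitten2000, arXiv:2401.10507]
#4 FiniteSizeCriterion (support; PROVED in tree, Theorems/OneCertifiedCubeFiniteSizeCriterion*.lean)
— (card K2, the gauge-covariant DS/MO criterion, here a theorem with universal threshold) for n ≥ 1,
ε ≥ 0 with ε·((4n+3)⁴−(4n+1)⁴) < 1 there is κ > 0 such that for every compact G with a continuous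
faithful matrix representation ρ and every pair A, B of local gauge-invariant observables there is C
with: for every β, every b ≥ 1 at which the TV finite-size condition (as in CrossoverCertificate,
with ρ, β, b, n, ε) holds, every torus of side 2S+1 ≥ (8n+7)b and every time separation t ≤ S,
|⟨A·τ_tB⟩ − ⟨A⟩⟨B⟩| ≤ C e^{−κt/b} under `wilsonMeasure ρ β` (C independent of β, b, S, t). Proof
sketch (planner): Ψ(N) := sup over cell-union volumes V (in ℤ⁴ or a torus), cells B ⊂ V and b.c.
differing only at cell-distance ≥ N of the TV distance of the B-marginals of γ_V; localise to A = V
∩ cube(B), disintegrate over the shell, couple: Ψ(N) ≤ ε·M(n)·Ψ(N−2n−1) by the TV chain rule over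
the ≤ M(n) shell cells (each conditional is a kernel of a smaller cell-union volume by consistency,
`isSpecification_ymSpecification_t2_holds`); covariances on the torus are bounded by
2‖A‖‖B‖·#cells(A)·Ψ(dist). [difficulty: L] (why it might fail: The typed hypothesis fixes
[b,2b]-frames, the central cell and the shell count M(n); if the TV chain rule over shell cells or
the torus seam kernels need shapes or configurations not covered, the universal exponent fails and
an e^{cβ} interaction-norm factor (fatal at weak coupling) returns.) [Martinelli1999,
Martinelli2000, DobrushinShlosman1987, BergMaes1994, DyerEtAl2004, Weitz2005, Georgii2011]
#5 GapToContinuum (crux) — (card assembly step "clustering passes to the limit"; restated 2026-08-16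
with the weak-coupling hypothesis and the PAIR-UNIFORM threshold the refuters rreview g2/g3 and
g40-63 advised) for every compact G, r, sch with β_k → ∞, T with `IsYangMillsFor r sch T` and Δ > 0:
if ONE threshold k₀ serves every pair (A, B) of gauge-invariant local lattice observables — ∃k₀ ∀A B
∃C ∀k ≥ k₀ ∀S ≥ L_k ∀n ≤ S, |⟨A·τ_nB⟩_{k,S} − ⟨A⟩⟨B⟩| ≤ C e^{−Δ a_k n} (exactly what `closes`
produces; it implies the statement's `HasLatticeMassGap`) — then `T.HasMassGap Δ`: at each fixed k ≥
k₀ all pairs cluster, so the reflection-positive transfer matrix (β_k ≥ 0 eventually;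
Osterwalder–Seiler RP on odd tori, tree `wilsonExpectation_oddReflectionPositive`) has the spectral
measure of every ÂΩ in {1} ∪ [0, e^{−a_kΔ}] with norm constants, and the convergence on ⁰𝒮 plus
E0/E0′ continuity transfer the clustering to every truncated Schwinger function of T. [difficulty:
L] (why it might fail: IsYangMillsFor is pointwise convergence per off-diagonal tensor — continuum
times are only limits n_k a_k → t, so an equicontinuity/3ε step must be proved; the odd-torus
transfer-matrix construction from wilsonExpectation RP is not in tree; E0′ off tensor test functions
is load-bearing.) [OsterwalderSeiler1978, GlimmJaffe1987, JaffeWitten2000, Seiler1982,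
OsterwalderSchrader1975]
#9 SU2OneCube (support) — (the literal "one certified cube", special case of CrossoverCertificate at
one k; finite but astronomically large, so a TARGET FOR REFUTERS' Monte-Carlo proxy rather than for
provers) for SU(2) in the fundamental representation, tree normalisation β = β_std/2, there are β ∈
[1.15, 1.5] (β_std ∈ [2.3, 3.0], the scaling window) and a cell size 4 ≤ b ≤ 24 such that the TV
finite-size condition holds with n = 1, ε = 1/2000 (ε·M(1) = 1776/2000 < 1). [difficulty: XL]
[LuciniTeperWenger2004, Luscher1986, KollerVanbaal1986, DobrushinKolafaShlosman1985]

TWO-LAYER PLAN. Foreseen glued splits (k ≤ 3, depth 1), filed only when a crux closes or a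
definition lands: CrossoverCertificate ⇐ InfluenceConverges (the TV
influence functional Θ_k(ℓ, n) of the fine theory has a k-uniform modulus of continuity / limit
along any NT∧NG scheme — the UV leg with
constants, Bałaban enclosure or flowed-observable route) → LimitCertificate (Θ_∞(ℓ, n) < 1/M(n) at
one (ℓ, n): the certified computation, SDP /
interval arithmetic on the crossover effective action) → CrossoverCertificate (openness: strict
inequality at the limit + convergence).
FiniteSizeCriterion ⇐ WeakMixingRecursion (Ψ(N) ≤ εM Ψ(N−2n−1) on ℤ⁴ and on tori) → TorusCovariance
(covariance ≤ 2‖A‖‖B‖ #cells Ψ) → F.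
GapToContinuum ⇐ LatticeSpectralGap (pairwise uniform clustering ⇒ transfer-matrix gap at each k) →
SpectralToSchwinger → P.

KILL CRITERIA. ¬FiniteSizeCriterion by an explicit specification/torus counterexample kills the
engine: restate once with the missing hypothesis if the
counterexample is a formalisation artefact (seam cells, shapes), else `close --reason
refuted:FiniteSizeCriterion`. ¬CrossoverCertificate of the
form "TV influence → 1 along every asymptotically free scheme" (UV mutual singularity of interior
laws) forces a pivot to a WEIGHTED
(Wasserstein / block-observable) influence and a new criterion with non-universal threshold — a
different route; close this one.
¬GapToContinuum (now with the pair-uniform antecedent): restate P with the spectral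
(transfer-matrix) form of the lattice gap as hypothesis and add the upgrade pair-uniform clustering
⇒ spectral gap as a crux.
ContinuumLimitExists refuted = the Clay statement is false. A proof elsewhere of `HasLatticeMassGap`
along a constructive scheme moots C and F.

NOT DECOMPOSED YET. The UV half of C (enclosure / convergence of influences, constants), the
certified computation itself (which G first: SU(2); large-N uniformity
of the certificate for the classical series; exceptional groups), the measure-theoretic lemmas of F
(TV chain rule for kernels on `LGConfig`,
torus specification and its seams, optimal couplings), reflection positivity on odd tori and the
OS-limit bookkeeping of P, and every E-side
question (E1, E0′, non-Gaussianity of tr F²) — all layer-2 children or other routes' business.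

CHEAPEST FALSIFIER. Monte-Carlo proxy for SU2OneCube / C (cheap, standard code): SU(2) Wilson
heat-bath on the cube of 7 cells of side b (lattice 7b per side;
b = 4 → 28⁴, b = 6 → 42⁴) at β_std = 2.4–2.5 with FIXED boundary links outside the cube, two
boundary conditions (cold η ≡ 1 vs one frozen
Haar sample); compare ⟨½ tr U_p⟩ and small Wilson loops inside the central cell: any difference >
5.6·10⁻⁴ (= 1/M(1)) at a given b
lower-bounds the TV influence and kills that b; if the difference does not fall below
5.6·10⁻⁴·(safety 10⁻¹) by b = 24 (2 cells ≈ 30–60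
glueball lengths) the certificate is hopeless at n = 1 and the line is in serious trouble. Expected
from e^{−m·2b·a}: b = 4 marginal
(e^{−7} ≈ 9·10⁻⁴), b ≥ 6 passes. Lookup falsifier for F: a published counterexample to "TV weak
mixing at one scale with ε·(shell cells) < 1 ⇒
exponential weak mixing for regular volumes" (none found: Martinelli2000, DyerEtAl2004, Weitz2005
prove statements of this type for bounded spins).

NUMBERS. M(n) = (4n+3)⁴ − (4n+1)⁴: M(1) = 1776, M(2) = 8080; threshold ε < 1/M(n) (5.63·10⁻⁴ at n =
1); torus side ≥ (8n+7)b = 15b at n = 1; delivered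
rate κ = log(1/(εM))/(4(n+1)) per cell-distance, Δ = κ/(2ℓ). Physical scale: m_{0++}/√σ ≈ 3.7
(SU(2)), ≈ 3.5 (SU(3)) [LuciniTeperWenger2004];
finite-volume effects ∝ e^{−(√3/2) m L} [Luscher1986]; crossover of the SU(2) finite-volume spectrum
at z = mL ≈ 1–5 [KollerVanbaal1986]; so
e^{−2mℓ}·O(1) ≤ 5.6·10⁻⁴ needs mℓ ≳ 4–5, cube side 7ℓ ≈ 30/m ≈ 3.5 fm. SU(2) tree coupling β =
β_std/2; β_std = 2.5: a√σ ≈ 0.19, ξ_{0++} ≈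
1.4a. Items at open: 6 (4 cruxes, 1 support, 1 assembly); after retriage + rev 4: 3 cruxes (C r2, E
r3, P r5), 2 supports (F proved, SU2OneCube), 1 assembly (proved = closes).

DEFINITION REQUESTS. None filed: every decl elaborates over existing vocabulary (`ymSpecification`,
`IsCylinder`, `LGConfig`, `latticeConnectedCorr`,
`LocalGaugeObservable`, `IsYangMillsFor`, `HasLatticeMassGap`, `OSData.HasMassGap`,
`fundamentalRep`). The inline finite-size condition
(one source text, gen_sketch.py in the planner folder) is repeated verbatim in F, C and SU2OneCube;
a later definition item
`cellInfluenceLE ρ β b n ε : Prop` in Literature/Probability/LatticeModels (TV influence of a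
specification w.r.t. a cell frame) would let a
tenure pass restate all three compactly.

Novelty: Searches (2026-08-15): `lit search --hybrid` ×4 (DS criterion; weak/strong mixing gauge; TV
influence block spin; finite-size criterion gauge
mass gap — only textbook hits: Martinelli1999 pp. 155–163 read, FriedliVelenik2017); `lit galaxy
search "Dobrushin-Shlosman" | "constructive
criterion…" | "strong spatial mixing" | "disagreement percolation" --star all` (30/0/10/13 rows,
none gauge); `lit search --source crossref` ×4
(finite-size criterion gauge: Martinelli2000, Forsstrom2022; Dobrushin uniqueness gauge: none beyond
DobrushinShlosman1985); `lit frontier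
QuantumFields --since 2020` (30 rows; arXiv:2401.10507, arXiv:2606.19362 noted), `lit bridges
QuantumFields --cross any`; arXiv/OpenAlex/S2 rate-limited (429).
Nearest prior art found: DobrushinShlosman1985/1987 + DobrushinKolafaShlosman1985 (finite-volume
constructive criteria, computer-verified once);
Martinelli1999 Prop. 2.9 / Martinelli2000 (finite-size conditions ⇒ exponential decay, constants
e^{c‖J‖}); BergMaes1994, DyerEtAl2004, Weitz2005
(coupling / combinatorial finite-size criteria, bounded discrete spins); Kennedy1993,
HallerKennedy1996 (DS finite-size conditions verified by
computer for RG block measures); tree `LatticeGaugeDobrushin` (single-link Dobrushin, strong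
coupling only); Forsstrom2022 (decay of
correlations, finite ABELIAN gauge groups).
Delta: a total-variation finite-size criterion with interaction-free threshold ε·M(n) < 1, stated on
the kernels of the Wilson specification over
[b,2b]-cell frame  [refs: 2401.10507, 2606.19362, Martinelli1999, FriedliVelenik2017, Martinelli2000, Forsstrom2022, DobrushinShlosman1985, DobrushinKolafaShlosman1985, BergMaes1994, DyerEtAl2004, Weitz2005, Kennedy1993, HallerKennedy1996]

Barriers (technique_class: finite-size-mixing-criterion, tv-influence, certificate): - technique_class: finite-size-mixing-criterion, tv-influence, certificate
- Literature.Barriers.QuantumFields.FixedCouplingUltralocality: respected — C is stated along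
schemes with a non-trivial non-Gaussian limit, which forces β_k → ∞ and b_k = ⌈ℓ/a_k⌉ → ∞ in lattice
units; nothing is claimed at fixed coupling.
- Literature.Barriers.QuantumFields.UVStabilityNonUniqueness: it does not evade it for E (existence
with the axioms is the open UV problem, ranked 3); for C the bet is that only CONVERGENCE OF
INFLUENCES (a bounded functional) along the scheme is needed, not uniqueness of the limit, and the
strict inequality is open. (Cross-summit, not in this catalogue: the CriticalPhenomena barrier on RG
non-Gibbsianness, PositionSpaceRGNonGibbsian, is evaded by construction — no block-spin image
measure is ever asked to be Gibbsian; the criterion lives on the fine specification and block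
structure enters only through cell frames.)
- Literature.Barriers.QuantumFields.PerturbativeInvisibility: consistent — perturbation theory at
most transports the theory to the scale ℓ; the gap constant κ/(2ℓ) comes from the non-perturbative
inequality ε·M(n) < 1.
- Literature.Barriers.QuantumFields.AbelianDeconfinementD4: evaded — F is group-blind but its
HYPOTHESIS is group-specific: for U(1) at weak coupling the TV influence does not decay (massless
photon) and C is restricted to simple G (U(1)×SU(2)-type products are excluded by
`IsCompactSimpleLieGroup`, cf. card abelian-factor-refutes-all-cou

Novelty grade: new-combination — ROUTE REVIEW rreview-0815T13-6-g2 (refuter gen 2, 2026-08-15). Grade INHERITED from the card audit of finite-size-criterion-crossover (new-combination: DS85/DKS85/Kennedy93/HK96 certified finite-size criteria ⊕ Bałaban crossover action ⊕ certified Haar integrals; not re-audited). Route delta vs card (refuter refuter-rreview-0815T13-6-g2-0, 2026-08-15T14:48:28Z; prior: doi:10.1007/bf01208821 (Dobrushin–Kolafa–Shlosman 1985); doi:10.1007/bf01048038 (Kennedy 1993); doi:10.1007/bf02199358 (Haller–Kennedy 1996); DobrushinShlosman1985/1987; Martinelli1999 §2 / Martinelli2000; BergMaes1994; DyerEtAl2004;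 Weitz2005; Balaban1988Convergent)

History (route lifecycle, newest last):
- 2026-08-15T16:10:55Z · rev 3: dropped UnitaryGroupNotSimple — cone repair gen 2: drop the non-thesis marker item UnitaryGroupNotSimple (stmt-QuantumFields-9774). It is not load-bearing — closes uses only FiniteSizeCriterio (planner-rrepair-QuantumFields-OneCertifiedCube-db755a3c-g2-0)
- 2026-08-16T17:42:47Z · rev 4: restated ContinuumLimitExists (stmt-QuantumFields-8894), CrossoverCertificate (stmt-QuantumFields-8893), GapToContinuum (stmt-QuantumFields-8896) — route-repair (statement-revised p116790: `def YangMills` gained the first conjunct `sch.HasWeakCouplingLimit`). β_k → ∞ cannot be derived from IsYangMillsFor ∧ (planner-rrepair-QuantumFields-OneCertifiedCube-c4dea256-0)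
- 2026-08-26T09:38:24Z · DORMANT — reconciler: no traction for 8.4 d (last activity item-evidence-added at 2026-08-17T23:28:24Z); parked, not closed — `ledger route dormant route-QuantumFields-On (operator:999:926293)
- 2026-08-28T21:22:06Z · REACTIVATED — reconciler: reactivated — activity statement-checked at 2026-08-28T18:56:30Z after parking at 2026-08-26T09:38:24Z (operator:999:2875844)
- 2026-09-03T10:20:24Z · DORMANT — reconciler: no traction for 5 d (last activity statement-checked at 2026-08-29T09:29:08Z); parked, not closed — `ledger route dormant route-QuantumFields-OneCer (operator:999:393832)

sub-problem: YangMills · status: dormant · opened planner-plancard-QuantumFields-YangMills-fini-c681d5c9-0 2026-08-15T13:39:54Z · rev 5 · ledger route-QuantumFields-OneCertifiedCube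
GENERATED by the gate from the ledger (D-0016/17). Provers cite these decls: `theorem foo : Summit.QuantumFields.YangMills.Theses.OneCertifiedCube.<Decl> := …` in Summits/QuantumFields/YangMills/Theorems/<Name>.lean.
-/

namespace Summit.QuantumFields.YangMills.Theses.OneCertifiedCube

open scoped BigOperators Topology Manifold Classical MeasureTheory ProbabilityTheory Matrix InnerProductSpace ComplexConjugate ContinuousMap
open Filter Set Function TopologicalSpace MeasureTheory

attribute [summit_statement] _root_.YangMills

-- earlier CrossoverCertificate (stmt-QuantumFields-8893, replaced 2026-08-16T17:42:47Z -> stmt-QuantumFields-16125): retired by None — ∀ (G : Type) [Group G] [TopologicalSpace G] [IsTopologicalGroup G] [CompactSpace G] [MeasurableSpace G] [BorelSpace G], Literature.MathematicalPhysics.QuantumFieldTheory.IsCompactSimpleLieGroup G → ∀ (r : Literature.MathematicalPhysics.QuantumFieldTheory.LatticeRep G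
/-- item stmt-QuantumFields-16125 · crux · rank 2 · open · by planner
why it might fail: TV sup over ALL exterior data incl. COHERENT cutoff-scale layers (constant abelian flux sheets): in the massive-GFF/abelian caricature TV→1 linearly in b=ℓ/a_k (refuter g3, gff_tv.py, job j001681), so C bets on YM-specific non-perturbative self-screening as β_k→∞; ε<1/1776 ⇒ ℓ≈5/m.
sources: DobrushinShlosman1985, Balaban1989LargeFieldII, Guth1980, tHooft1979Flux, DobrushinKolafaShlosman1985, HallerKennedy1996
[crux] (card K1+K3, the certificate with openness built in; re-typed 2026-08-16 to WEAK-COUPLING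
schemes) for every compact simple G, every faithful lattice representation r, every scheme sch with
β_k → ∞ (`sch.HasWeakCouplingLimit`) and OS data T with `IsYangMillsFor r sch T`, non-trivial and
non-Gaussian curvature field, there are a physical length ℓ > 0, n ≥ 1 and ε ≥ 0 with ε·M(n) < 1,
M(n) = (4n+3)⁴ − (4n+1)⁴, such that for all large k the TV finite-size condition holds for the
Wilson specification at β_k with cell size b_k = ⌈ℓ/a_k⌉: for every [b_k,2b_k]-frame w, every
cell-union A inside the cube of (4n+1)⁴ cells containing the central cell, every pair of boundary
conditions agreeing on the cube, and every [0,1]-valued measurable cylinder function f of the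
central cell, |∫f dγ_A(·|η) − ∫f dγ_A(·|η′)| ≤ ε. The added hypothesis β_k → ∞ is exactly what the
statement's witness now carries (`closes` threads it through): the certified cube sits in the
small-field / crossover regime BY HYPOTHESIS instead of by the informal 'a non-trivial limit forces
β_k → ∞'. Live risk recorded by refuter rreview-0815T13-6-g3 on the superseded item
stmt-QuantumFields-8893 (evidence gff_tv.py, comp -/
@[route_item "route-QuantumFields-OneCertifiedCube"]
def CrossoverCertificate : Prop :=
  ∀ (G : Type) [Group G] [TopologicalSpace G] [IsTopologicalGroup G] [CompactSpace G] [MeasurableSpace G] [BorelSpace G], Literature.MathematicalPhysics.QuantumFieldTheory.IsCompactSimpleLieGroup G → ∀ (r : Literature.MathematicalPhysics.QuantumFieldTheory.LatticeRep G) (sch : Literature.MathematicalPhysics.QuantumFieldTheory.SpeciesScheme (Literature.MathematicalPhysics.QuantumFieldTheory.YMSpecies G)) (T : Literature.MathematicalPhysics.QuantumFieldTheory.OSData (Literature.MathematicalPhysics.QuantumFieldTheory.YMSpecies G) 4), sch.HasWeakCouplingLimit → Literature.MathematicalPhysics.QuantumFieldTheory.IsYangMillsFor r sch T → T.IsNontrivial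 r.curvature → T.IsNonGaussian r.curvature → ∃ ℓ : ℝ, 0 < ℓ ∧ ∃ (n : ℕ) (ε : ℝ), 1 ≤ n ∧ 0 ≤ ε ∧ ε * ((((4 * n + 3) ^ 4 - (4 * n + 1) ^ 4 : ℕ)) : ℝ) < 1 ∧ ∀ᶠ k : ℕ in Filter.atTop, (∀ w : Fin 4 → ℤ → ℤ, (∀ i j, w i j + ((⌈ℓ / sch.a k⌉₊ : ℕ) : ℤ) ≤ w i (j + 1) ∧ w i (j + 1) ≤ w i j + 2 * ((⌈ℓ / sch.a k⌉₊ : ℕ) : ℤ)) → ∀ Y : Finset (Fin 4 → ℤ), Y ⊆ (Fintype.piFinset fun _ : Fin 4 => Finset.Icc (-(2 * ((n : ℕ) : ℤ))) (2 * ((n : ℕ) : ℤ))) → (0 : Fin 4 → ℤ) ∈ Y → ∀ η η' : Literature.MathematicalPhysics.QuantumLattice.LGConfig 4 G, (∀ e ∈ (Fintype.piFinset fun _ : Fin 4 => Finset.Icc (-(2 * ((n : ℕ) : ℤ))) (2 * ((n : ℕ) : ℤ))).biUnion (fun y : Fin 4 → ℤ => (Fintype.piFinset fun i : Fin 4 =>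 Finset.Ico (w i (y i)) (w i (y i + 1))) ×ˢ (Finset.univ : Finset (Fin 4))), η e = η' e) → ∀ f : Literature.MathematicalPhysics.QuantumLattice.LGConfig 4 G → ℝ, Literature.MathematicalPhysics.QuantumLattice.IsCylinder f ((fun y : Fin 4 → ℤ => (Fintype.piFinset fun i : Fin 4 => Finset.Ico (w i (y i)) (w i (y i + 1))) ×ˢ (Finset.univ : Finset (Fin 4))) 0) → Measurable f → (∀ U, 0 ≤ f U ∧ f U ≤ 1) → |(∫ U, f U ∂(Literature.MathematicalPhysics.QuantumLattice.ymSpecification r.ρ (sch.β k) (Y.biUnion (fun y : Fin 4 → ℤ => (Fintype.piFinset fun i : Fin 4 => Finset.Ico (w i (y i)) (w i (y i + 1))) ×ˢ (Finset.univ : Finset (Fin 4)))) η)) - ∫ U, f U ∂(Literature.MathematicalPhysics.QuantumLattice.ymSpecification r.ρ (sch.β k) (Y.biUnion (fun y : Fin 4 → ℤ => (Fintype.piFinset fun i : Fin 4 => Finset.Ico (w i (y i)) (w i (y i + 1))) ×ˢ (Finset.univ : Finset (Fin 4)))) η')| ≤ ε)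

-- earlier ContinuumLimitExists (stmt-QuantumFields-8894, replaced 2026-08-16T17:42:47Z -> stmt-QuantumFields-16124): retired by None — ∀ (G : Type) [Group G] [TopologicalSpace G] [IsTopologicalGroup G] [CompactSpace G], Literature.MathematicalPhysics.QuantumFieldTheory.IsCompactSimpleLieGroup G → letI : MeasurableSpace G := borel G; haveI : BorelSpace G := ⟨rfl⟩; ∃ (r : Literature.MathematicalPhysic
/-- item stmt-QuantumFields-16124 · crux · rank 3 · open · by planner
why it might fail: Existence of continuum YM₄ with E0–E4 (E1 full rotations, E0′ growth) and non-Gaussian tr F² (κ₃≠0) for EVERY compact simple G along β_k → ∞: Bałaban's programme stops at UV stability (barrier UVStabilityNonUniqueness); rotations, E0′ and the 3-point lower bound are open.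
sources: Balaban1987RG1, Balaban1989LargeFieldII, Balaban1988Convergent, MagnenRivasseauSeneor1993, JaffeWitten2000, arXiv:2401.10507
[crux] (existence leg AT WEAK COUPLING = the re-typed statement's existence clauses without the gap;
statement re-type p116790, 2026-08-16) for every compact simple G there are a faithful lattice
representation r, a sequential scheme sch with a_k → 0, a_k L_k → ∞ AND β_k → ∞
(`sch.HasWeakCouplingLimit`: the continuum limit is taken at the asymptotically free ultraviolet
fixed point g₀² = 2/β_k → 0 — as every constructive supplier (Bałaban's renormalised trajectory,
flowed observables; cards parabolic-renormalised-trajectory / flow-line-state-space-4d) does anyway;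
a hypothetical finite-β critical point no longer qualifies) and OS data T (E0, E0′, E1–E4 as fields)
for all gauge-invariant local observables with `IsYangMillsFor r sch T`, `T.IsNontrivial
r.curvature` and `T.IsNonGaussian r.curvature`. Supersedes the pre-re-type text of the same decl
(strictly stronger: adds the conjunct β_k → ∞, which `closes` returns as the statement's new first
conjunct and threads into CrossoverCertificate and GapToContinuum). [difficulty: open-problem] -/
@[route_item "route-QuantumFields-OneCertifiedCube"]
def ContinuumLimitExists : Prop :=
  ∀ (G : Type) [Group G] [TopologicalSpace G] [IsTopologicalGroup G] [CompactSpace G], Literature.MathematicalPhysics.QuantumFieldTheory.IsCompactSimpleLieGroup G → letI : MeasurableSpace G := borel G; haveI : BorelSpace G := ⟨rfl⟩; ∃ (r : Literature.MathematicalPhysics.QuantumFieldTheory.LatticeRep G) (sch : Literature.MathematicalPhysics.QuantumFieldTheory.SpeciesScheme (Literature.MathematicalPhysics.QuantumFieldTheory.YMSpecies G)) (T : Literature.MathematicalPhysics.QuantumFieldTheory.OSData (Literature.MathematicalPhysics.QuantumFieldTheory.YMSpecies G) 4), sch.HasWeakCouplingLimit ∧ Literature.MathematicalPhysics.QuantumFieldTheory.IsYangMillsFor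 r sch T ∧ T.IsNontrivial r.curvature ∧ T.IsNonGaussian r.curvature

-- earlier GapToContinuum (stmt-QuantumFields-8896, replaced 2026-08-16T17:42:47Z -> stmt-QuantumFields-16126): open — ∀ (G : Type) [Group G] [TopologicalSpace G] [IsTopologicalGroup G] [CompactSpace G] [MeasurableSpace G] [BorelSpace G] (r : Literature.MathematicalPhysics.QuantumFieldTheory.LatticeRep G) (sch : Literature.MathematicalPhysics.QuantumFieldTheory.SpeciesScheme (Literature.MathematicalP
/-- item stmt-QuantumFields-16126 · crux · rank 5 · open · by planner
why it might fail: IsYangMillsFor is POINTWISE convergence per off-diagonal tensor: continuum times t are only limits n_k a_k → t, so an equicontinuity/3ε step (RP + norm bounds + E1 continuity) must be proved; the odd-torus transfer matrix built from wilsonExpectation RP is not in tree; E0′ off tensors is used.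
sources: OsterwalderSeiler1978, Seiler1982, GlimmJaffe1987, JaffeWitten2000, OsterwalderSchrader1975, Literature.MathematicalPhysics.QuantumFieldTheory.wilsonExpectation_oddReflectionPositive
[crux] (card assembly step "clustering passes to the limit"; restated 2026-08-16: weak-coupling
scheme + PAIR-UNIFORM threshold, as refuters rreview-0815T13-6-g2/g3 and refute-pool g40-63 advised
on the superseded item stmt-QuantumFields-8896) for every compact G, faithful r, scheme sch with β_k
→ ∞ (`sch.HasWeakCouplingLimit`), OS data T with `IsYangMillsFor r sch T` and Δ > 0: IF there is ONE
threshold k₀ such that for every pair (A, B) of gauge-invariant local lattice observables there is C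
with |⟨A·τ_nB⟩_{k,S} − ⟨A⟩⟨B⟩| ≤ C e^{−Δ a_k n} for all k ≥ k₀, all tori of side 2S+1 with S ≥ L_k
and all n ≤ S (the pair-uniform form of `HasLatticeMassGap`; `closes` produces exactly this — its k₀
comes from the eventualities of CrossoverCertificate, a_k ≤ ℓ and (8n+7)ℓ ≤ a_k L_k, all
pair-independent — and derives the statement's `HasLatticeMassGap` clause from it), THEN
`T.HasMassGap Δ`. Intended proof: at each fixed k ≥ k₀ ALL pairs cluster at rate Δ a_k on all large
odd tori ⇒ (β_k ≥ 0 eventually, so Osterwalder–Seiler reflection positivity of Wilson's action on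
odd tori applies — tree `wilsonExpectation_oddReflectionPositive` needs exactly `0 ≤ β`) the
spectral measure of every vector -/
@[route_item "route-QuantumFields-OneCertifiedCube"]
def GapToContinuum : Prop :=
  ∀ (G : Type) [Group G] [TopologicalSpace G] [IsTopologicalGroup G] [CompactSpace G] [MeasurableSpace G] [BorelSpace G] (r : Literature.MathematicalPhysics.QuantumFieldTheory.LatticeRep G) (sch : Literature.MathematicalPhysics.QuantumFieldTheory.SpeciesScheme (Literature.MathematicalPhysics.QuantumFieldTheory.YMSpecies G)) (T : Literature.MathematicalPhysics.QuantumFieldTheory.OSData (Literature.MathematicalPhysics.QuantumFieldTheory.YMSpecies G) 4) (Δ : ℝ), 0 < Δ → sch.HasWeakCouplingLimit → Literature.MathematicalPhysics.QuantumFieldTheory.IsYangMillsFor r sch T → (∃ k₀ : ℕ, ∀ A B : Literature.MathematicalPhysics.QuantumFieldTheory.YMSpecies G, ∃ C : ℝ, ∀ k : ℕ, k₀ ≤ k → ∀ S : ℕ, sch.L k ≤ S → ∀ n : ℕ, n ≤ S → |Literature.MathematicalPhysics.QuantumFieldTheory.latticeConnectedCorr r.ρ (sch.β k) (2 * S + 1)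 A.F B.F n| ≤ C * Real.exp (-(Δ * (sch.a k * n)))) → T.HasMassGap Δ

/-- item stmt-QuantumFields-8895 · support · rank 4 · closed · proved by Summit.QuantumFields.YangMills.Theorems.FiniteSizeCriterion_proof @ c8344c03cabf (prover) · by planner
why it might fail: The typed hypothesis fixes [b,2b]-frames, the central cell and the shell count M(n); if the TV chain rule over shell cells or the torus seam kernels need shapes or configurations not covered, the universal exponent fails and an e^{cβ} interaction-norm factor (fatal at weak coupling) returns.
sources: DobrushinShlosman1985, BergMaes1994, Weitz2005, Martinelli1999, Martinelli2000, DyerEtAl2004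
[crux] (card K2, the gauge-covariant DS/MO criterion, here a theorem with universal threshold) for n
≥ 1, ε ≥ 0 with ε·((4n+3)⁴−(4n+1)⁴) < 1 there is κ > 0 such that for every compact G with a
continuous faithful matrix representation ρ and every pair A, B of local gauge-invariant observables
there is C with: for every β, every b ≥ 1 at which the TV finite-size condition (as in
CrossoverCertificate, with ρ, β, b, n, ε) holds, every torus of side 2S+1 ≥ (8n+7)b and every time
separation t ≤ S, |⟨A·τ_tB⟩ − ⟨A⟩⟨B⟩| ≤ C e^{−κt/b} under `wilsonMeasure ρ β` (C independent of β,
b, S, t). Proof sketch (planner): Ψ(N) := sup over cell-union volumes V (in ℤ⁴ or a torus), cells B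
⊂ V and b.c. differing only at cell-distance ≥ N of the TV distance of the B-marginals of γ_V;
localise to A = V ∩ cube(B), disintegrate over the shell, couple: Ψ(N) ≤ ε·M(n)·Ψ(N−2n−1) by the TV
chain rule over the ≤ M(n) shell cells (each conditional is a kernel of a smaller cell-union volume
by consistency, `isSpecification_ymSpecification_t2_holds`); covariances on the torus are bounded by
2‖A‖‖B‖·#cells(A)·Ψ(dist). [difficulty: L] -/
@[route_item "route-QuantumFields-OneCertifiedCube"]
def FiniteSizeCriterion : Prop :=
  ∀ (n : ℕ) (ε : ℝ), 1 ≤ n → 0 ≤ ε → ε * ((((4 * n + 3) ^ 4 - (4 * n + 1) ^ 4 : ℕ)) : ℝ) < 1 → ∃ κ : ℝ, 0 < κ ∧ ∀ (G : Type) [Group G] [TopologicalSpace G] [IsTopologicalGroup G] [CompactSpace G] [MeasurableSpace G] [BorelSpace G] (N : ℕ) (ρ : G →* Matrix (Fin N) (Fin N) ℂ), Continuous ρ → Function.Injective ρ → ∀ A B : Literature.MathematicalPhysics.QuantumLattice.LocalGaugeObservable 4 G, ∃ C : ℝ, ∀ (β : ℝ) (b : ℕ), 1 ≤ b → (∀ w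 : Fin 4 → ℤ → ℤ, (∀ i j, w i j + ((b : ℕ) : ℤ) ≤ w i (j + 1) ∧ w i (j + 1) ≤ w i j + 2 * ((b : ℕ) : ℤ)) → ∀ Y : Finset (Fin 4 → ℤ), Y ⊆ (Fintype.piFinset fun _ : Fin 4 => Finset.Icc (-(2 * ((n : ℕ) : ℤ))) (2 * ((n : ℕ) : ℤ))) → (0 : Fin 4 → ℤ) ∈ Y → ∀ η η' : Literature.MathematicalPhysics.QuantumLattice.LGConfig 4 G, (∀ e ∈ (Fintype.piFinset fun _ : Fin 4 => Finset.Icc (-(2 * ((n : ℕ) : ℤ))) (2 * ((n : ℕ) : ℤ))).biUnion (fun y : Fin 4 → ℤ => (Fintype.piFinset fun i : Fin 4 => Finset.Ico (w i (y i)) (w i (y i + 1))) ×ˢ (Finset.univ : Finset (Fin 4))), η e = η' e) → ∀ f : Literature.MathematicalPhysics.QuantumLattice.LGConfig 4 G → ℝ, Literature.MathematicalPhysics.QuantumLattice.IsCylinder f ((fun y : Fin 4 → ℤ => (Fintype.piFinset fun i : Fin 4 => Finset.Ico (w i (y i)) (w i (y i + 1))) ×ˢ (Finset.univ : Finset (Fin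 4))) 0) → Measurable f → (∀ U, 0 ≤ f U ∧ f U ≤ 1) → |(∫ U, f U ∂(Literature.MathematicalPhysics.QuantumLattice.ymSpecification ρ β (Y.biUnion (fun y : Fin 4 → ℤ => (Fintype.piFinset fun i : Fin 4 => Finset.Ico (w i (y i)) (w i (y i + 1))) ×ˢ (Finset.univ : Finset (Fin 4)))) η)) - ∫ U, f U ∂(Literature.MathematicalPhysics.QuantumLattice.ymSpecification ρ β (Y.biUnion (fun y : Fin 4 → ℤ => (Fintype.piFinset fun i : Fin 4 => Finset.Ico (w i (y i)) (w i (y i + 1))) ×ˢ (Finset.univ : Finset (Fin 4)))) η')| ≤ ε) → ∀ S : ℕ, (8 * n + 7) * b ≤ 2 * S + 1 → ∀ t : ℕ, t ≤ S → |Literature.MathematicalPhysics.QuantumFieldTheory.latticeConnectedCorr ρ β (2 * S + 1) A.F B.F t| ≤ C * Real.exp (-(κ * t / b))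

-- `FiniteSizeCriterion` holds: proved by `Summit.QuantumFields.YangMills.Theorems.FiniteSizeCriterion_proof` @ c8344c03cabf (its module imports this route file, so no `_holds` link can be stated here).

/-- item stmt-QuantumFields-8897 · support · rank 9 · open · by planner
sources: LuciniTeperWenger2004, Luscher1986, KollerVanbaal1986, DobrushinKolafaShlosman1985
[support] (the literal "one certified cube", special case of CrossoverCertificate at one k; finite
but astronomically large, so a TARGET FOR REFUTERS' Monte-Carlo proxy rather than for provers) for
SU(2) in the fundamental representation, tree normalisation β = β_std/2, there are β ∈ [1.15, 1.5]
(β_std ∈ [2.3, 3.0], the scaling window) and a cell size 4 ≤ b ≤ 24 such that the TV finite-size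
condition holds with n = 1, ε = 1/2000 (ε·M(1) = 1776/2000 < 1). [difficulty: XL] -/
@[route_item "route-QuantumFields-OneCertifiedCube"]
def SU2OneCube : Prop :=
  ∃ β : ℝ, (23 : ℝ) / 20 ≤ β ∧ β ≤ 3 / 2 ∧ ∃ b : ℕ, 4 ≤ b ∧ b ≤ 24 ∧ (let G := ↥(Matrix.specialUnitaryGroup (Fin 2) ℂ); (∀ w : Fin 4 → ℤ → ℤ, (∀ i j, w i j + ((b : ℕ) : ℤ) ≤ w i (j + 1) ∧ w i (j + 1) ≤ w i j + 2 * ((b : ℕ) : ℤ)) → ∀ Y : Finset (Fin 4 → ℤ), Y ⊆ (Fintype.piFinset fun _ : Fin 4 => Finset.Icc (-(2 * ((1 : ℕ) : ℤ))) (2 * ((1 : ℕ) : ℤ))) → (0 : Fin 4 → ℤ) ∈ Y → ∀ η η' : Literature.MathematicalPhysics.QuantumLattice.LGConfig 4 G, (∀ e ∈ (Fintype.piFinset fun _ : Fin 4 => Finset.Icc (-(2 * ((1 : ℕ) : ℤ))) (2 * ((1 : ℕ) : ℤ))).biUnion (fun y : Fin 4 → ℤ => (Fintype.piFinset fun i :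 Fin 4 => Finset.Ico (w i (y i)) (w i (y i + 1))) ×ˢ (Finset.univ : Finset (Fin 4))), η e = η' e) → ∀ f : Literature.MathematicalPhysics.QuantumLattice.LGConfig 4 G → ℝ, Literature.MathematicalPhysics.QuantumLattice.IsCylinder f ((fun y : Fin 4 → ℤ => (Fintype.piFinset fun i : Fin 4 => Finset.Ico (w i (y i)) (w i (y i + 1))) ×ˢ (Finset.univ : Finset (Fin 4))) 0) → Measurable f → (∀ U, 0 ≤ f U ∧ f U ≤ 1) → |(∫ U, f U ∂(Literature.MathematicalPhysics.QuantumLattice.ymSpecification (Literature.MathematicalPhysics.QuantumLattice.fundamentalRep (Fin 2)) β (Y.biUnion (fun y : Fin 4 → ℤ => (Fintype.piFinset fun i : Fin 4 => Finset.Ico (w i (y i)) (w i (y i + 1))) ×ˢ (Finset.univ : Finset (Fin 4)))) η)) - ∫ U, f U ∂(Literature.MathematicalPhysics.QuantumLattice.ymSpecification (Literature.MathematicalPhysics.QuantumLattice.fundamentalRep (Fin 2)) β (Y.biUnion (fun y : Fin 4 → ℤ => (Fintype.piFinset fun i : Fin 4 => Finset.Ico (w i (y i)) (w i (y i + 1)))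 ×ˢ (Finset.univ : Finset (Fin 4)))) η')| ≤ ((1 : ℝ) / 2000)))

/-- item stmt-QuantumFields-8898 · assembly · rank 1 · closed · proved by Summit.QuantumFields.YangMills.Theorems.oneCertifiedCube_assembly_proof (prover) · by planner
sources: JaffeWitten2000, DobrushinShlosman1985
[assembly] FiniteSizeCriterion → ContinuumLimitExists → CrossoverCertificate → GapToContinuum →
YangMills. -/
@[route_item "route-QuantumFields-OneCertifiedCube"]
def Assembly : Prop :=
  FiniteSizeCriterion → ContinuumLimitExists → CrossoverCertificate → GapToContinuum → YangMills

-- `Assembly` holds: proved by `Summit.QuantumFields.YangMills.Theorems.oneCertifiedCube_assembly_proof` (its module imports this route file, so no `_holds` link can be stated here).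

/-! D-0027 §2.1 — DECIDING THEOREM (planner-authored via `route open/edit --closes-file`; by planner-rrepair-QuantumFields-OneCertifiedCube-c4dea256-0 2026-08-16T17:42:47Z):
its hypotheses are this route's items and its conclusion the sub-problem Statement (glue_lint), and it elaborates with this file. -/

@[closes "route-QuantumFields-OneCertifiedCube"] theorem closes (hF : FiniteSizeCriterion) (hE : ContinuumLimitExists) (hC : CrossoverCertificate)
    (hP : GapToContinuum) : YangMills := by
  -- D-0027 §2.1 deciding theorem, re-elaborated after the statement re-type p116790 (2026-08-16):
  -- E gives (r, sch, T) WITH the weak-coupling clause hW : sch.HasWeakCouplingLimit (β_k → ∞), which is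
  -- threaded into C and P and returned as the statement's new first conjunct; C gives (ℓ, n, ε) and the
  -- finite-size condition eventually in k; F gives κ(n, ε) and per-pair constants; Δ := κ/(2ℓ); a
  -- PAIR-INDEPENDENT threshold k₀ (finite-size condition ∧ a_k ≤ ℓ ∧ (8n+7)ℓ ≤ a_k L_k) yields the
  -- pair-uniform lattice gap hU, hence `HasLatticeMassGap`; P upgrades hU to `T.HasMassGap Δ`.
  intro G _ _ _ _ hG
  letI : MeasurableSpace G := borel G
  haveI : BorelSpace G := ⟨rfl⟩
  obtain ⟨r, sch, T, hW, hYM, hNT, hNG⟩ := hE G hG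
  obtain ⟨ℓ, hℓ, n, ε, hn, hε, hM, hev⟩ := hC G hG r sch T hW hYM hNT hNG
  obtain ⟨κ, hκ, hF'⟩ := hF n ε hn hε hM
  have hAB := hF' G r.N r.ρ r.continuous r.injective
  have hΔ : 0 < κ / (2 * ℓ) := by positivity
  have ev1 : ∀ᶠ k in Filter.atTop, sch.a k ≤ ℓ := sch.tendsto_a.eventually (eventually_le_nhds hℓ)
  have ev2 : ∀ᶠ k in Filter.atTop, ((8 * (n : ℝ) + 7) * ℓ) ≤ sch.a k * (sch.L k : ℝ) :=
    sch.tendsto_L.eventually (Filter.eventually_ge_atTop _)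
  -- the pair-independent threshold
  obtain ⟨k₀, hk₀⟩ := Filter.eventually_atTop.mp ((hev.and ev1).and ev2)
  -- pair-uniform lattice gap at rate κ/(2ℓ) from step k₀ on
  have hU : ∀ A B : Literature.MathematicalPhysics.QuantumFieldTheory.YMSpecies G, ∃ C : ℝ, ∀ k : ℕ, k₀ ≤ k →
      ∀ S : ℕ, sch.L k ≤ S → ∀ t : ℕ, t ≤ S →
        |Literature.MathematicalPhysics.QuantumFieldTheory.latticeConnectedCorr r.ρ (sch.β k) (2 * S + 1) A.F B.F t| ≤
          C * Real.exp (-(κ / (2 * ℓ) * (sch.a k * t))) := by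
    intro A B
    obtain ⟨C, hCb⟩ := hAB A B
    refine ⟨C, fun k hk0 S hS t ht => ?_⟩
    obtain ⟨⟨hk, h1⟩, h2⟩ := hk₀ k hk0
    have ha : 0 < sch.a k := sch.a_pos k
    have hq : 0 < ℓ / sch.a k := div_pos hℓ ha
    -- the block size b_k = ⌈ℓ / a_k⌉₊ and its elementary bounds
    have hb1 : 1 ≤ ⌈ℓ / sch.a k⌉₊ := Nat.one_le_iff_ne_zero.mpr (Nat.pos_iff_ne_zero.mp (Nat.ceil_pos.mpr hq))
    have hble : ((⌈ℓ / sch.a k⌉₊ : ℕ) : ℝ) ≤ ℓ / sch.a k + 1 := (Nat.ceil_lt_add_one hq.le).le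
    have hbpos : (0 : ℝ) < ((⌈ℓ / sch.a k⌉₊ : ℕ) : ℝ) := by exact_mod_cast hb1
    have hab : ((⌈ℓ / sch.a k⌉₊ : ℕ) : ℝ) * sch.a k ≤ 2 * ℓ := by
      calc ((⌈ℓ / sch.a k⌉₊ : ℕ) : ℝ) * sch.a k ≤ (ℓ / sch.a k + 1) * sch.a k := by gcongr
        _ = ℓ + sch.a k := by field_simp
        _ ≤ 2 * ℓ := by linarith
    -- torus side: (8n+7) b_k ≤ 2 L_k + 1 ≤ 2 S + 1
    have hside : (8 * n + 7) * ⌈ℓ / sch.a k⌉₊ ≤ 2 * S + 1 := by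
      have hreal : ((8 * (n : ℝ) + 7)) * ((⌈ℓ / sch.a k⌉₊ : ℕ) : ℝ) ≤ 2 * (sch.L k : ℝ) + 1 := by
        have h3 : ((8 * (n : ℝ) + 7) * ((⌈ℓ / sch.a k⌉₊ : ℕ) : ℝ)) * sch.a k
            ≤ (2 * (sch.L k : ℝ)) * sch.a k := by
          calc ((8 * (n : ℝ) + 7) * ((⌈ℓ / sch.a k⌉₊ : ℕ) : ℝ)) * sch.a k
              = (8 * (n : ℝ) + 7) * (((⌈ℓ / sch.a k⌉₊ : ℕ) : ℝ) * sch.a k) := by ring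
            _ ≤ (8 * (n : ℝ) + 7) * (2 * ℓ) := by gcongr
            _ = 2 * ((8 * (n : ℝ) + 7) * ℓ) := by ring
            _ ≤ 2 * (sch.a k * (sch.L k : ℝ)) := by gcongr
            _ = (2 * (sch.L k : ℝ)) * sch.a k := by ring
        have h4 : (8 * (n : ℝ) + 7) * ((⌈ℓ / sch.a k⌉₊ : ℕ) : ℝ) ≤ 2 * (sch.L k : ℝ) :=
          le_of_mul_le_mul_right h3 ha
        linarith
      have hnat : (8 * n + 7) * ⌈ℓ / sch.a k⌉₊ ≤ 2 * sch.L k + 1 := by exact_mod_cast hreal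
      omega
    have hbound := hCb (sch.β k) ⌈ℓ / sch.a k⌉₊ hb1 hk S hside t ht
    have hC0 : 0 ≤ C := by
      have h0 : 0 ≤ C * Real.exp (-(κ * (t : ℝ) / ((⌈ℓ / sch.a k⌉₊ : ℕ) : ℝ))) :=
        (abs_nonneg _).trans hbound
      exact nonneg_of_mul_nonneg_left h0 (Real.exp_pos _)
    refine hbound.trans ?_
    gcongr
    -- exponent comparison: κ/(2ℓ) · (a_k t) ≤ κ t / b_k
    have ht0 : (0 : ℝ) ≤ (t : ℝ) := by exact_mod_cast Nat.zero_le t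
    rw [div_mul_eq_mul_div, div_le_div_iff₀ (by positivity) hbpos]
    calc κ * (sch.a k * (t : ℝ)) * ((⌈ℓ / sch.a k⌉₊ : ℕ) : ℝ)
        = κ * (t : ℝ) * (((⌈ℓ / sch.a k⌉₊ : ℕ) : ℝ) * sch.a k) := by ring
      _ ≤ κ * (t : ℝ) * (2 * ℓ) := by gcongr
  have hgap : Literature.MathematicalPhysics.QuantumFieldTheory.HasLatticeMassGap r sch (κ / (2 * ℓ)) := fun A B =>
    (hU A B).imp fun C hCk => Filter.eventually_atTop.mpr ⟨k₀, hCk⟩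
  exact ⟨r, sch, T, hW, hYM, hNT, hNG, κ / (2 * ℓ), hΔ, hP G r sch T _ hΔ hW hYM ⟨k₀, hU⟩, hgap⟩

end Summit.QuantumFields.YangMills.Theses.OneCertifiedCube
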